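import Literature.IUT.LogVolume.TensorPacketShell
import HarnessLib

/-!
# The Haar MODULUS of a `ℚ_p`-linear automorphism of a tensor packet: volume, admissibility, `log μ̄`

Classical Haar-measure facts (proof-only; no new definition), complementing `PadicLinearLatticeVolume.lean`
(«Deliberately NOT here: … the modulus of a general linear automorphism») and `TensorPacketMeasure.lean`
(`packetVol_smul`: the modulus rule for MULTIPLICATIVE translates `A ↦ g·A`): for an ARBITRARY `ℚ_p`-linear
automorphism `φ` of a finite-dimensional `ℚ_p`-vector space `W` (module topology) and any integral structure `Λ`,
`μ_Λ(φ(A)) = μ_Λ(φ(Λ))·μ_Λ(A)` for EVERY `A ⊆ W`, with modulus `0 < μ_Λ(φ(Λ)) < ∞` — Weil's modulus of an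
automorphism of a locally compact group ([AbsTopIII] Prop. 5.7 (i)(b) p. 138 "`μ(x·A) = μ̇(x)·μ(A)`" is the case
`φ = (x·−)`); hence on the real tensor packet `V = ⊗_{ℚ_p} k_i` of Dupuy–Hilado Def. 3.6.1 (`packetVol`, `PacketAdm`,
`packetLogμ` of `TensorPacketMeasure.lean`, read through the chosen decomposition `ψ : V ≃ ⊕_j L_j`):

* `packetVol_image_linearEquiv`: `μ(φ(A)) = μ(φ((R_I)^∼))·μ(A)` for every `ℚ_p`-linear automorphism `φ` of `V`;
* `packetAdm_image_linearEquiv_normalizedPacket`, `packetAdm_image_linearEquiv_iff`: `φ((R_I)^∼)` is admissible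
  (the modulus is positive and finite) and `φ(A)` is admissible iff `A` is;
* `packetLogμ_image_linearEquiv`: **`log μ̄(φ(A)) = log μ̄(φ((R_I)^∼)) + log μ̄(A)`** for admissible `A` — the
  normalised log-measure is shifted by the CONSTANT `log μ̄(φ((R_I)^∼))` («volume character» of `φ`), which
  vanishes exactly for the measure-preserving `φ` (e.g. the lattice automorphisms of `indTwo`,
  `packetLogμ_image_of_mem`).

Everything is a THEOREM of Mathlib's Haar measure via the tree's `IntegralStructure.haar_image` (Haar uniqueness)
and `IsModuleTopology.continuous_of_linearMap`. [cite: MochizukiAbsTopIII2015, Prop. 5.7 (i)(b) p. 138]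
[cite: DupuyHilado2025, Def. 3.6.1, §3.7] Written by a block-E test seat of the abc-iut cell (abc-iut-E-t43) for
the volume-character dichotomy (`Summits/ABC/IUTFork/Joshi/TestVolumeCharacterDichotomy.lean`); nothing disputed is
used or asserted here.
-/

noncomputable section

open MeasureTheory Set
open scoped ENNReal

namespace Literature.IUT.LogVolume

/-! ## 1. The modulus of a `ℚ_p`-linear automorphism -/

namespace PadicModule

variable (p : ℕ) [Fact p.Prime]
variable {W : Type*} [AddCommGroup W] [Module ℚ_[p] W] [TopologicalSpace W] [IsModuleTopology ℚ_[p] W]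
  [IsTopologicalAddGroup W] [MeasurableSpace W] [BorelSpace W]

/-- **Weil's modulus rule for a `ℚ_p`-linear automorphism**: `μ_Λ(φ(A)) = μ_Λ(φ(Λ))·μ_Λ(A)` for EVERY `A ⊆ W`
(`φ`, `φ⁻¹` are continuous in the module topology; `IntegralStructure.haar_image`).
[cite: MochizukiAbsTopIII2015, Prop. 5.7 (i)(b) p. 138] -/
theorem haar_image_linearEquiv (Λ : IntegralStructure W) (φ : W ≃ₗ[ℚ_[p]] W) (A : Set W) :
    Λ.haar (φ '' A) = Λ.haar (φ '' (Λ : Set W)) * Λ.haar A :=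
  haveI : ContinuousAdd W := IsModuleTopology.toContinuousAdd ℚ_[p] W
  Λ.haar_image
    { φ.toAddEquiv with
      continuous_toFun := IsModuleTopology.continuous_of_linearMap φ.toLinearMap
      continuous_invFun := IsModuleTopology.continuous_of_linearMap φ.symm.toLinearMap } A

/-- The modulus `μ_Λ(φ(Λ))` is positive. [cite: MochizukiAbsTopIII2015, Prop. 5.7 (i)(b) p. 138] -/
theorem haar_image_self_linearEquiv_pos (Λ : IntegralStructure W) (φ : W ≃ₗ[ℚ_[p]] W) :
    0 < Λ.haar (φ '' (Λ : Set W)) :=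
  haveI : ContinuousAdd W := IsModuleTopology.toContinuousAdd ℚ_[p] W
  Λ.haar_image_self_pos
    { φ.toAddEquiv with
      continuous_toFun := IsModuleTopology.continuous_of_linearMap φ.toLinearMap
      continuous_invFun := IsModuleTopology.continuous_of_linearMap φ.symm.toLinearMap }

/-- The modulus `μ_Λ(φ(Λ))` is finite. [cite: MochizukiAbsTopIII2015, Prop. 5.7 (i)(b) p. 138] -/
theorem haar_image_self_linearEquiv_lt_top (Λ : IntegralStructure W) (φ : W ≃ₗ[ℚ_[p]] W) :
    Λ.haar (φ '' (Λ : Set W)) < ∞ :=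
  haveI : ContinuousAdd W := IsModuleTopology.toContinuousAdd ℚ_[p] W
  Λ.haar_image_self_lt_top
    { φ.toAddEquiv with
      continuous_toFun := IsModuleTopology.continuous_of_linearMap φ.toLinearMap
      continuous_invFun := IsModuleTopology.continuous_of_linearMap φ.symm.toLinearMap }

end PadicModule

/-! ## 2. On the real tensor packet `V = ⊗_{ℚ_p} k_i` -/

section Packet

open Literature.NumberTheory.GaloisRepresentations.Ultrametric

variable (p : ℕ) [Fact p.Prime]
variable {I : Type} [Fintype I] [DecidableEq I]
variable (k : I → Type) [∀ i, NontriviallyNormedField (k i)] [∀ i, NormedAlgebra ℚ_[p] (k i)]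
  [∀ i, IsUltrametricDist (k i)] [∀ i, ProperSpace (k i)] [Nonempty I]

omit [DecidableEq I] [∀ i, IsUltrametricDist (k i)] [Nonempty I] in
/-- Conjugating `φ` by the decomposition `ψ`: `(ψ ∘ φ ∘ ψ⁻¹)(ψ(A)) = ψ(φ(A))`. [cite: DupuyHilado2025, Def. 3.6.1] -/
theorem image_dEquiv_conj (φ : PacketAlgebra p k ≃ₗ[ℚ_[p]] PacketAlgebra p k) (A : Set (PacketAlgebra p k)) :
    ((dEquiv p k).toLinearEquiv.symm.trans (φ.trans (dEquiv p k).toLinearEquiv)) '' (dEquiv p k '' A) =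
      dEquiv p k '' (φ '' A) := by
  rw [image_image, image_image]
  refine image_congr fun a _ => ?_
  simp

/-- **The modulus rule on the tensor packet**: `μ(φ(A)) = μ(φ((R_I)^∼))·μ(A)` for every `ℚ_p`-linear automorphism
`φ` of `V` and every `A ⊆ V`. [cite: DupuyHilado2025, Def. 3.6.1, §3.7] -/
theorem packetVol_image_linearEquiv (φ : PacketAlgebra p k ≃ₗ[ℚ_[p]] PacketAlgebra p k) (A : Set (PacketAlgebra p k)) :
    packetVol p k (φ '' A) =
      packetVol p k (φ '' (normalizedPacket p k : Set (PacketAlgebra p k))) * packetVol p k A := by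
  haveI : IsModuleTopology ℚ_[p] (DSum p k) := isModuleTopologyOfFiniteDimensional
  unfold packetVol
  rw [← image_dEquiv_conj, ← image_dEquiv_conj, image_normalizedPacket_eq_coe]
  exact PadicModule.haar_image_linearEquiv p _ _ _

/-- `φ((R_I)^∼)` is admissible: the modulus of `φ` is positive and finite. [cite: DupuyHilado2025, Def. 3.6.1] -/
theorem packetAdm_image_linearEquiv_normalizedPacket (φ : PacketAlgebra p k ≃ₗ[ℚ_[p]] PacketAlgebra p k) :
    PacketAdm p k (φ '' (normalizedPacket p k : Set (PacketAlgebra p k))) := by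
  haveI : IsModuleTopology ℚ_[p] (DSum p k) := isModuleTopologyOfFiniteDimensional
  unfold PacketAdm packetVol
  rw [← image_dEquiv_conj, image_normalizedPacket_eq_coe]
  exact ⟨PadicModule.haar_image_self_linearEquiv_pos p _ _, PadicModule.haar_image_self_linearEquiv_lt_top p _ _⟩

/-- `φ(A)` is admissible if `A` is. [cite: DupuyHilado2025, Def. 3.6.1] -/
theorem packetAdm_image_linearEquiv (φ : PacketAlgebra p k ≃ₗ[ℚ_[p]] PacketAlgebra p k)
    {A : Set (PacketAlgebra p k)} (hA : PacketAdm p k A) : PacketAdm p k (φ '' A) := by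
  have hO := packetAdm_image_linearEquiv_normalizedPacket p k φ
  refine ⟨?_, ?_⟩
  · rw [packetVol_image_linearEquiv p k φ]
    exact ENNReal.mul_pos hO.1.ne' hA.1.ne'
  · rw [packetVol_image_linearEquiv p k φ]
    exact ENNReal.mul_lt_top hO.2 hA.2

/-- … and conversely. [cite: DupuyHilado2025, Def. 3.6.1] -/
theorem packetAdm_of_image_linearEquiv (φ : PacketAlgebra p k ≃ₗ[ℚ_[p]] PacketAlgebra p k)
    {A : Set (PacketAlgebra p k)} (hA : PacketAdm p k (φ '' A)) : PacketAdm p k A := by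
  have hO := packetAdm_image_linearEquiv_normalizedPacket p k φ
  have h := packetVol_image_linearEquiv p k φ A
  refine ⟨?_, ?_⟩
  · by_contra h0
    rw [not_lt, nonpos_iff_eq_zero] at h0
    rw [h0, mul_zero] at h
    exact hA.1.ne' h
  · by_contra htop
    rw [not_lt, top_le_iff] at htop
    rw [htop, ENNReal.mul_top hO.1.ne'] at h
    exact hA.2.ne h

/-- **Admissibility is invariant** under every `ℚ_p`-linear automorphism of the packet. [cite: DupuyHilado2025, Def. 3.6.1] -/
theorem packetAdm_image_linearEquiv_iff (φ : PacketAlgebra p k ≃ₗ[ℚ_[p]] PacketAlgebra p k)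
    (A : Set (PacketAlgebra p k)) : PacketAdm p k (φ '' A) ↔ PacketAdm p k A :=
  ⟨packetAdm_of_image_linearEquiv p k φ, packetAdm_image_linearEquiv p k φ⟩

/-- **The volume character of a linear automorphism**: `log μ̄(φ(A)) = log μ̄(φ((R_I)^∼)) + log μ̄(A)` for admissible
`A` — the normalised log-measure is shifted by a constant independent of `A`. [cite: DupuyHilado2025, Def. 3.6.1, §3.7] -/
theorem packetLogμ_image_linearEquiv (φ : PacketAlgebra p k ≃ₗ[ℚ_[p]] PacketAlgebra p k)
    {A : Set (PacketAlgebra p k)} (hA : PacketAdm p k A) :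
    packetLogμ p k (φ '' A) =
      packetLogμ p k (φ '' (normalizedPacket p k : Set (PacketAlgebra p k))) + packetLogμ p k A := by
  have hO := packetAdm_image_linearEquiv_normalizedPacket p k φ
  simp only [packetLogμ_eq, IntegralStructure.normalizedLogVolume, IntegralStructure.logVolume]
  rw [← add_div]
  congr 1
  have h := packetVol_image_linearEquiv p k φ A
  unfold PacketAdm packetVol at h hO hA
  rw [h, ENNReal.toReal_mul, Real.log_mul (ENNReal.toReal_pos hO.1.ne' hO.2.ne).ne'
    (ENNReal.toReal_pos hA.1.ne' hA.2.ne).ne']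

/-- The character vanishes for the lattice automorphisms of `indTwo` (consistency with `packetLogμ_image_of_mem`).
[cite: DupuyHilado2025, §4.9] -/
theorem packetLogμ_image_normalizedPacket_of_mem {φ : PacketAlgebra p k ≃ₗ[ℚ_[p]] PacketAlgebra p k}
    (hφ : φ ∈ indTwo p k) : packetLogμ p k (φ '' (normalizedPacket p k : Set (PacketAlgebra p k))) = 0 := by
  rw [packetLogμ_image_of_mem p k hφ, packetLogμ_normalizedPacket]

end Packet

end Literature.IUT.LogVolume

end
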